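import Summits.Parity.GeneralizedHardyLittlewood.Theorems.LeeYangFibresRelativeDimOneSplitCosetMean3
import HarnessLib

/-!
# Coset singular means IV: the registered stub `stub_cosetSingularMean`
(crux stmt-Parity-14113 `LeeYangFibres.RelativeDimOne`, line gallagher-backwards-split, file 4 of 4)

We prove `stub_cosetSingularMean : ∀ θ₁ < 1/2, CosetSingularMean θ₁` (vocabulary
`LeeYangFibresRelativeDimOneSplitDefs`): for all `t ≥ 1, L, δ > 0, ε > 0` there is `N₀` such that for
`N ≥ N₀`, every modulus `1 ≤ q ≤ N^{θ₁}`, coefficients `a_i ≠ 0` with `∑|a_i| ≤ L`, residues `c`, and every box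
`∏ [u_l, u_l + X_l] ⊆ [−LN, LN]^t` with `X_l ≥ δ N`,
`|∑_{b ∈ box, b ≡ c (q), sys a b non-degenerate} 𝔖(sys a b) − (∏_{p ∣ q} β_p(a,c)) · #{b ∈ box : b ≡ c (q)}|
 ≤ ε (q/φ(q))^t ∏(X_l+1)/q^t`  (Gallagher 1976, §2; Goldston–Suriajaya 2021, along a progression; for
`t` forms and uniformly in `q ≤ √N`).

## Proof (`coset_estimate`, then the choice of constants in `cosetSingularMean_of_le_half`)

With `y = y_N = ⌊log N/4⌋`, `S₂ = {p ≤ y : p ∤ q}`, `P₂ = ∏ S₂ ≤ ∏_{p ≤ y} p ≤ N^{0.35}`,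
`F₂(b) = ∏_{p ∈ S₂} β_p(sys a b)` and `LTF = ∏_{p ∣ q} β_p(a, c)`:
1. TAILS: for non-degenerate `b` in the coset `C`, `𝔖(sys a b) = (1 + O(δ')) LTF · F₂(b)` (file III, with the
   truncation set `{p ∣ q} ∪ S₂ ⊇ {p ≤ y}`; the factors at `p ∣ q` are frozen along the coset).
2. EXACT AVERAGES: over the coset of a block box `∏ [u_l, u_l + m_l P₂ q)` both `∑ F₂` and the number of
   points equal `(∏ m_l) P₂^t` (files I–II: `𝔼_{b mod p} β_p(a,b) = 1` exactly and CRT); sandwiching the box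
   between the block boxes with `m_l = ⌊(X_l+1)/(P₂q)⌋` and `m_l + 1` gives `V₀ ≤ ∑_C F₂, #C ≤ V₁` with
   `V₁ ≤ 2^t ∏(X_l+1)/q` and `V₁ − V₀ ≤ V₁ t/(m_min + 1) = o(V₁)` (`m_l + 1 ≥ δN/(P₂ q) → ∞` as `q ≤ √N`).
3. DEGENERATE SHIFTS lie on `≤ t²` hyperplanes `a_i b_j = a_j b_i`, so `#D ≤ t² #C / n_min` with
   `n_min ≥ ⌊δN⌋/q ≥ δ√N/2`, while `F₂ ≤ y^t = o(√N)`.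
4. Bookkeeping: `|∑_{C*} 𝔖 − LTF #C| ≤ LTF (δ' V₁ + (V₁ − V₀) + y^t #D) ≤ (5ε/8) LTF ∏(X_l+1)/q` and
   `LTF ≤ (q/φ(q))^t`.
Only `θ₁ ≤ 1/2` is used (through `q ≤ N^{θ₁} ≤ √N`).

References: P. X. Gallagher, Mathematika 23 (1976), §2 [Gallagher1976]; D. A. Goldston, A. I. Suriajaya (2021),
Lemma 1; B. Green, T. Tao, Ann. of Math. 171 (2010), (1.6)–(1.7), Lemma 1.3 [GreenTao2010].
-/

noncomputable section

open scoped BigOperators Classical Topology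
open Finset Filter Literature.NumberTheory.Sieve

namespace Summit.Parity.GeneralizedHardyLittlewood.Cruxes.RelativeDimOne.GallagherBackwardsSplit

namespace CosetMeanProof

open TranslateAmplification (truncLevel)
open TranslateAmplification.SingularTailProof (exists_threshold)

variable {t : ℕ}

/-! ### The estimate for one modulus, one coset, one box -/

/-- THE COSET ESTIMATE at a good scale `N` (all thresholds as hypotheses): with `y = y_N`, `R = √N`,
`S₂ = {p ≤ y : p ∤ q}`, `P₂ = ∏ S₂`, the coset `C = {b ∈ ∏[u_l, u_l + X_l] : b ≡ c (q)}` and its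
non-degenerate part `C*`,
`|∑_{C*} 𝔖(a,b) − LTF · #C| ≤ LTF · (δ' 2^t + 2^t t η/δ + 2 t² 2^t η/δ) · ∏_l (X_l+1)/q`, `LTF = ∏_{p∣q} β_p(a,c)`:
tails `𝔖 = (1 ± δ') LTF · F₂` on `C*` (`abs_singularProduct_sub_prod_le`, `F₂ = ∏_{p ∈ S₂} β_p`), the exact
coset sums `∑_{block coset} F₂ = #(block coset) = (∏ m_l) P₂^t` sandwiching `∑_C F₂` and `#C` between the
volumes `V₀ ≤ V₁ ≤ 2^t ∏ (X_l+1)/q` of two block boxes with `V₁ − V₀ ≤ V₁ t η/δ`, and the degenerate shifts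
(`#D · n₀ ≤ t² #C`, `F₂ ≤ y^t`, `y^t ≤ η R`, `n₀ ≥ δ R/2`). -/
theorem coset_estimate {N q y L : ℕ} (hN : 0 < N) (hq : 0 < q) (hy2 : 2 ≤ y) (hyL : L * (t + 1) ≤ y)
    (hyT : 2 * t ≤ y) (ht : 1 ≤ t) {δ' : ℝ} (hδ'0 : 0 < δ') (hδ'1 : δ' ≤ 1)
    (hσ : (t : ℝ) ^ 2 / y + 4 * t / y * ((t : ℝ) ^ 2 *
      (Real.log ((2 * (L * (t + 1)) ^ 2 * N : ℕ) : ℝ) / Real.log y)) ≤ δ' / 2)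
    {δ η R : ℝ} (hδ : 0 < δ) (hη0 : 0 < η) (hηδ : η ≤ δ) (hRR : R * R = N) (hqR : (q : ℝ) ≤ R)
    (hRδ : 4 / δ ≤ R) (hPR : ((primorial y : ℕ) : ℝ) ≤ η * R) (hyR : (y : ℝ) ^ t ≤ η * R)
    (a c u : Fin t → ℤ) (ha : ∀ i, a i ≠ 0) (haL : ∑ i, |a i| ≤ (L : ℤ)) (X : Fin t → ℕ)
    (hX : ∀ i, δ * N ≤ (X i : ℝ)) (hu : ∀ i, -((L : ℝ) * N) ≤ u i ∧ (u i : ℝ) + X i ≤ L * N) :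
    |(∑ b ∈ (box u X).filter
          (fun b => (∀ i, b i ≡ c i [ZMOD q]) ∧ IsNondegenerateSystem (sys a b)),
        singularProduct (sys a b))
      - localTypeFactor q a c * (((box u X).filter (fun b => ∀ i, b i ≡ c i [ZMOD q])).card : ℝ)|
      ≤ localTypeFactor q a c * ((δ' * 2 ^ t + 2 ^ t * t * (η / δ) + 2 * t ^ 2 * 2 ^ t * (η / δ)) *
          ∏ l, (((X l : ℝ) + 1) / q)) := by
  have hN0 : (0 : ℝ) < N := by exact_mod_cast hN
  have hq0 : (0 : ℝ) < q := by exact_mod_cast hq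
  have hR0 : 0 < R := lt_of_lt_of_le (by positivity) hRδ
  have hy1 : 1 ≤ y := le_trans (by norm_num) hy2
  have ht0 : (0 : ℝ) < t := by exact_mod_cast ht
  -- the `q`-coprime truncation set
  set S₂ : Finset ℕ := (Nat.primesLE y).filter (fun p => ¬ p ∣ q) with hS₂
  have hS₂p : ∀ p ∈ S₂, p.Prime := fun p hp => (Nat.mem_primesLE.1 (Finset.mem_filter.1 hp).1).2
  have hS₂q : ∀ p ∈ S₂, ¬ p ∣ q := fun p hp => (Finset.mem_filter.1 hp).2
  have hS₂sub : S₂ ⊆ Nat.primesLE y := Finset.filter_subset _ _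
  obtain ⟨P₂, hP₂⟩ : ∃ P₂ : ℕ, ∏ p ∈ S₂, p = P₂ := ⟨_, rfl⟩
  have hP₂pos : 0 < P₂ := hP₂ ▸ Finset.prod_pos fun p hp => (hS₂p p hp).pos
  have hcop : Nat.Coprime P₂ q :=
    hP₂ ▸ Nat.Coprime.prod_left fun p hp => (Nat.Prime.coprime_iff_not_dvd (hS₂p p hp)).2 (hS₂q p hp)
  have hP₂P : (P₂ : ℝ) ≤ (primorial y : ℕ) := by
    have h1 : P₂ ∣ primorial y := by
      rw [primorial_eq_prod_primesLE, ← hP₂]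
      exact Finset.prod_dvd_prod_of_subset _ _ _ hS₂sub
    exact_mod_cast Nat.le_of_dvd (primorial_pos y) h1
  -- sizes: `P₂ q ≤ η N ≤ δ N ≤ X_l`
  have hP₂qN : (P₂ : ℝ) * q ≤ η * N :=
    calc (P₂ : ℝ) * q ≤ (η * R) * R := mul_le_mul (hP₂P.trans hPR) hqR hq0.le (by positivity)
      _ = η * N := by rw [mul_assoc, hRR]
  have hPq : ∀ l, P₂ * q ≤ X l + 1 := by
    intro l
    have h1 : ((P₂ * q : ℕ) : ℝ) ≤ X l + 1 := by
      push_cast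
      calc (P₂ : ℝ) * q ≤ η * N := hP₂qN
        _ ≤ δ * N := mul_le_mul_of_nonneg_right hηδ hN0.le
        _ ≤ X l := hX l
        _ ≤ X l + 1 := by linarith only
    exact_mod_cast h1
  -- block numbers `m_l = ⌊(X_l + 1)/(P₂ q)⌋`
  have hMpos : 0 < P₂ * q := Nat.mul_pos hP₂pos hq
  set m : Fin t → ℕ := fun l => (X l + 1) / (P₂ * q) with hm
  have hm1 : ∀ l, m l * (P₂ * q) ≤ X l + 1 := fun l => Nat.div_mul_le_self _ _
  have hm2 : ∀ l, X l + 1 ≤ (m l + 1) * (P₂ * q) := fun l => by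
    have := Nat.lt_div_mul_add (a := X l + 1) hMpos
    rw [add_mul, one_mul]
    exact this.le
  -- the coset, the coprime local product, the sandwich
  set C := (box u X).filter (fun b => ∀ l, b l ≡ c l [ZMOD q]) with hC
  set F₂ : (Fin t → ℤ) → ℝ := fun b => ∏ p ∈ S₂, localFactor (sys a b) p with hF₂
  have hF₂0 : ∀ b, 0 ≤ F₂ b := fun b => Finset.prod_nonneg fun _ _ => localFactor_nonneg _ _
  have hF₂le : ∀ b, F₂ b ≤ (y : ℝ) ^ t := fun b => prod_localFactor_le_pow (sys a b) hy1 S₂ hS₂sub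
  set V₀ : ℝ := (∏ l, (m l : ℝ)) * (P₂ : ℝ) ^ t with hV₀
  set V₁ : ℝ := (∏ l, ((m l : ℝ) + 1)) * (P₂ : ℝ) ^ t with hV₁
  have hB₀C := coset_block_subset (q := q) u c X m hm1
  have hCB₁ := subset_coset_block (q := q) u c X (fun l => m l + 1) hm2
  have hSB₀ := sum_coset_prod_localFactor hq S₂ hS₂p hS₂q a u c m
  have hSB₁ := sum_coset_prod_localFactor hq S₂ hS₂p hS₂q a u c (fun l => m l + 1)
  rw [hP₂] at hSB₀ hSB₁
  push_cast at hSB₁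
  have hcB₀ := card_coset hq hP₂pos hcop u c m
  have hcB₁ := card_coset hq hP₂pos hcop u c (fun l => m l + 1)
  push_cast at hcB₁
  have hSF_lo : V₀ ≤ ∑ b ∈ C, F₂ b :=
    calc V₀ = _ := hSB₀.symm
      _ ≤ ∑ b ∈ C, F₂ b := Finset.sum_le_sum_of_subset_of_nonneg hB₀C (fun b _ _ => hF₂0 b)
  have hSF_hi : ∑ b ∈ C, F₂ b ≤ V₁ :=
    calc ∑ b ∈ C, F₂ b ≤ _ := Finset.sum_le_sum_of_subset_of_nonneg hCB₁ (fun b _ _ => hF₂0 b)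
      _ = V₁ := hSB₁
  have hPc_lo : V₀ ≤ (#C : ℝ) :=
    calc V₀ = _ := hcB₀.symm
      _ ≤ (#C : ℝ) := by exact_mod_cast Finset.card_le_card hB₀C
  have hPc_hi : (#C : ℝ) ≤ V₁ :=
    calc (#C : ℝ) ≤ _ := by exact_mod_cast Finset.card_le_card hCB₁
      _ = V₁ := hcB₁
  -- `W = ∏ (X_l + 1)/q` and `V₁ ≤ 2^t W`
  set W : ℝ := ∏ l, (((X l : ℝ) + 1) / q) with hW
  have hW0 : 0 ≤ W := Finset.prod_nonneg fun l _ => by positivity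
  have hV₁W : V₁ ≤ 2 ^ t * W := block_volume_le hq hP₂pos X hPq
  have hV₁0 : 0 ≤ V₁ := by positivity
  -- (b) the two volumes are close: `V₁ − V₀ ≤ V₁ t η/δ`
  have hK1 : 1 ≤ δ / η := by rw [le_div_iff₀ hη0, one_mul]; exact hηδ
  have hKm : ∀ l, δ / η ≤ (m l : ℝ) + 1 := by
    intro l
    have h1 : ((X l + 1 : ℕ) : ℝ) ≤ ((m l + 1 : ℕ) : ℝ) * ((P₂ * q : ℕ) : ℝ) := by exact_mod_cast hm2 l
    have h3 : δ * N ≤ ((m l : ℝ) + 1) * (η * N) :=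
      calc δ * N ≤ X l := hX l
        _ ≤ ((X l + 1 : ℕ) : ℝ) := by push_cast; linarith only
        _ ≤ ((m l + 1 : ℕ) : ℝ) * ((P₂ * q : ℕ) : ℝ) := h1
        _ ≤ ((m l : ℝ) + 1) * (η * N) := by
            push_cast
            exact mul_le_mul_of_nonneg_left hP₂qN (by positivity)
    have h4 : δ ≤ ((m l : ℝ) + 1) * η := le_of_mul_le_mul_right (by linarith only [h3]) hN0
    rw [div_le_iff₀ hη0]
    exact h4
  have hVV : V₁ - V₀ ≤ V₁ * (t * (η / δ)) := by
    have h := one_sub_div_mul_prod_le hK1 m hKm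
    have h2 : (1 - t / (δ / η)) * V₁ ≤ V₀ := by
      rw [hV₁, hV₀, ← mul_assoc]
      exact mul_le_mul_of_nonneg_right h (by positivity)
    have e : (t : ℝ) / (δ / η) = t * (η / δ) := by field_simp
    rw [e] at h2
    linarith only [h2]
  -- (c) degenerate shifts: `#D · n₀ ≤ t² #C`, `n₀ ≥ δ R / 2`
  have hCpi : C = Fintype.piFinset (fun l => (Icc (u l) (u l + X l)).filter fun x => x ≡ c l [ZMOD q]) :=
    filter_box_modEq_eq q u c X
  set n₀ : ℕ := ⌊δ * N⌋₊ / q with hn₀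
  have hn₀le : ∀ l, n₀ ≤ #((Icc (u l) (u l + X l)).filter fun x => x ≡ c l [ZMOD q]) := by
    intro l
    refine le_trans (Nat.div_le_div_right ?_) (div_le_card_filter_Icc_modEq hq (u l) (c l) (X l))
    have : (⌊δ * N⌋₊ : ℝ) ≤ X l + 1 := (Nat.floor_le (by positivity)).trans (by linarith only [hX l])
    exact_mod_cast this
  have h24 : 2 / δ ≤ R := le_trans (div_le_div_of_nonneg_right (by norm_num) hδ.le) hRδ
  have hn₀R : δ * R / 2 ≤ (n₀ : ℝ) := floor_div_ge hδ hq hqR hRR h24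
  set D := C.filter (fun b => ¬ IsNondegenerateSystem (sys a b)) with hD
  have hDn : (#D : ℝ) * n₀ ≤ t * t * #C := by
    have h := card_filter_degenerate_mul_le
      (fun l => (Icc (u l) (u l + X l)).filter fun x => x ≡ c l [ZMOD q]) ha hn₀le
    rw [← Fintype.card_piFinset, ← hCpi] at h
    exact_mod_cast h
  have hSD0 : 0 ≤ ∑ b ∈ D, F₂ b := Finset.sum_nonneg fun b _ => hF₂0 b
  have hSD1 : ∑ b ∈ D, F₂ b ≤ (y : ℝ) ^ t * #D :=
    calc ∑ b ∈ D, F₂ b ≤ ∑ _b ∈ D, (y : ℝ) ^ t := Finset.sum_le_sum fun b _ => hF₂le b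
      _ = (y : ℝ) ^ t * #D := by rw [Finset.sum_const, nsmul_eq_mul, mul_comm]
  have hyD : (y : ℝ) ^ t * #D ≤ 2 * t ^ 2 * 2 ^ t * (η / δ) * W := by
    have hD1 : (#D : ℝ) * n₀ ≤ t * t * V₁ := hDn.trans (mul_le_mul_of_nonneg_left hPc_hi (by positivity))
    have h1 : (y : ℝ) ^ t * ((#D : ℝ) * n₀) ≤ (η * R) * (t * t * V₁) :=
      mul_le_mul hyR hD1 (by positivity) (by positivity)
    have h2 : (y : ℝ) ^ t * ((#D : ℝ) * (δ * R / 2)) ≤ (y : ℝ) ^ t * ((#D : ℝ) * n₀) :=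
      mul_le_mul_of_nonneg_left (mul_le_mul_of_nonneg_left hn₀R (by positivity)) (by positivity)
    have h3 : (η * R) * (t * t * V₁) ≤ (η * R) * (t * t * (2 ^ t * W)) :=
      mul_le_mul_of_nonneg_left (mul_le_mul_of_nonneg_left hV₁W (by positivity)) (by positivity)
    have h4 := h2.trans (h1.trans h3)
    rw [show 2 * (t : ℝ) ^ 2 * 2 ^ t * (η / δ) * W = (η * R * (t * t * (2 ^ t * W))) / (δ * R / 2) by
      field_simp, le_div_iff₀ (by positivity)]
    calc (y : ℝ) ^ t * #D * (δ * R / 2) = (y : ℝ) ^ t * ((#D : ℝ) * (δ * R / 2)) := by ring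
      _ ≤ _ := h4
  -- the tail on the non-degenerate part `C*`
  set Cstar := C.filter (fun b => IsNondegenerateSystem (sys a b)) with hCstar
  have hset : (box u X).filter (fun b => (∀ i, b i ≡ c i [ZMOD q]) ∧ IsNondegenerateSystem (sys a b)) =
      Cstar := (Finset.filter_filter _ _ _).symm
  set LTF := localTypeFactor q a c with hLTF
  have hLTF0 : 0 ≤ LTF := localTypeFactor_nonneg q a c
  set S' : Finset ℕ := q.primeFactors ∪ S₂ with hS'
  have hS'p : ∀ p ∈ S', p.Prime := by
    intro p hp
    rcases Finset.mem_union.1 hp with h | h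
    · exact Nat.prime_of_mem_primeFactors h
    · exact hS₂p p h
  have hyS' : Nat.primesLE y ⊆ S' := by
    intro p hp
    have hp' := (Nat.mem_primesLE.1 hp).2
    by_cases hpq : p ∣ q
    · exact Finset.mem_union_left _ (Nat.mem_primeFactors.2 ⟨hp', hpq, hq.ne'⟩)
    · exact Finset.mem_union_right _ (Finset.mem_filter.2 ⟨hp, hpq⟩)
  have hdisj : Disjoint q.primeFactors S₂ :=
    Finset.disjoint_left.2 fun p hp1 hp2 => hS₂q p hp2 (Nat.dvd_of_mem_primeFactors hp1)
  have hFS : ∀ b ∈ C, ∏ p ∈ S', localFactor (sys a b) p = LTF * F₂ b := by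
    intro b hb
    have hbc := (Finset.mem_filter.1 hb).2
    rw [hS', Finset.prod_union hdisj, prod_primeFactors_localFactor_eq a hbc]
  have htail : ∀ b ∈ Cstar, |singularProduct (sys a b) - LTF * F₂ b| ≤ δ' * (LTF * F₂ b) := by
    intro b hb
    obtain ⟨hbC, hbnd⟩ := Finset.mem_filter.1 hb
    rw [← hFS b hbC]
    refine abs_singularProduct_sub_prod_le (sys a b) hbnd hN ?_ hy2 hyL hyT hδ'0 hδ'1 hσ S' hS'p hyS'
    refine affLinSize_sys_le hN haL fun i => ?_
    have hbox := (Finset.mem_filter.1 hbC).1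
    rw [box, Fintype.mem_piFinset] at hbox
    have hi := Finset.mem_Icc.1 (hbox i)
    have h1 : (u i : ℝ) ≤ b i := by exact_mod_cast hi.1
    have h2 : (b i : ℝ) ≤ u i + X i := by exact_mod_cast hi.2
    rw [abs_le]
    constructor <;> linarith only [(hu i).1, (hu i).2, h1, h2]
  -- assembly
  have hsumC : ∑ b ∈ C, F₂ b = ∑ b ∈ Cstar, F₂ b + ∑ b ∈ D, F₂ b :=
    (Finset.sum_filter_add_sum_filter_not C (fun b => IsNondegenerateSystem (sys a b)) F₂).symm
  set E₁ := ∑ b ∈ Cstar, (singularProduct (sys a b) - LTF * F₂ b) with hE₁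
  have hSeq : ∑ b ∈ Cstar, singularProduct (sys a b) =
      E₁ + LTF * (∑ b ∈ C, F₂ b - ∑ b ∈ D, F₂ b) := by
    rw [hE₁, Finset.sum_sub_distrib, ← Finset.mul_sum, hsumC]
    ring
  have hE : |E₁| ≤ δ' * (LTF * (∑ b ∈ C, F₂ b - ∑ b ∈ D, F₂ b)) :=
    calc |E₁| ≤ ∑ b ∈ Cstar, |singularProduct (sys a b) - LTF * F₂ b| := Finset.abs_sum_le_sum_abs _ _
      _ ≤ ∑ b ∈ Cstar, δ' * (LTF * F₂ b) := Finset.sum_le_sum htail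
      _ = δ' * (LTF * (∑ b ∈ C, F₂ b - ∑ b ∈ D, F₂ b)) := by
          rw [← Finset.mul_sum, ← Finset.mul_sum, hsumC]
          ring
  have hmain := assembly_abs_le hLTF0 hδ'0.le hSeq hE hSF_hi hSF_lo hPc_lo hPc_hi hSD0 hSD1
  rw [hset]
  refine hmain.trans (mul_le_mul_of_nonneg_left ?_ hLTF0)
  have hA : δ' * V₁ ≤ δ' * (2 ^ t * W) := mul_le_mul_of_nonneg_left hV₁W hδ'0.le
  have hB : V₁ * (t * (η / δ)) ≤ (2 ^ t * W) * (t * (η / δ)) :=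
    mul_le_mul_of_nonneg_right hV₁W (by positivity)
  linarith only [hA, hB, hVV, hyD]

/-- `CosetSingularMean θ₁` for every `θ₁ ≤ 1/2`: choose `δ' = ε₁/2^{t+2}`, `η = ε₁ δ/(8 t² 2^t)`
(`ε₁ = min(ε, 1)`), the tail threshold of `exists_threshold` at `(t, L(t+1), δ'/2)`, and `N` so large that
`(∏_{p ≤ y_N} p) y_N^t ≤ η √N` and `√N ≥ 4/δ`; then `q ≤ N^{θ₁} ≤ √N` and `coset_estimate` gives the bound
with `LTF (5ε₁/8) ∏ (X_l+1)/q ≤ ε (q/φ(q))^t ∏ (X_l+1)/q^t`. -/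
theorem cosetSingularMean_of_le_half {θ₁ : ℝ} (hθ : θ₁ ≤ 1 / 2) : CosetSingularMean θ₁ := by
  intro t L ht δ ε hδ hε
  have ht0 : (0 : ℝ) < t := by exact_mod_cast ht
  set ε₁ : ℝ := min ε 1 with hε₁
  have hε₁0 : 0 < ε₁ := lt_min hε one_pos
  have hε₁ε : ε₁ ≤ ε := min_le_left _ _
  have hε₁1 : ε₁ ≤ 1 := min_le_right _ _
  set δ' : ℝ := ε₁ / 2 ^ (t + 2) with hδ'
  have hδ'0 : 0 < δ' := by positivity
  have hδ'1 : δ' ≤ 1 := by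
    rw [hδ', div_le_one (by positivity)]
    exact hε₁1.trans (one_le_pow₀ (by norm_num))
  set η : ℝ := ε₁ * δ / (8 * t ^ 2 * 2 ^ t) with hη
  have hη0 : 0 < η := by positivity
  have hηδ : η ≤ δ := by
    rw [hη, div_le_iff₀ (by positivity)]
    have h1 : (1 : ℝ) ≤ t ^ 2 := one_le_pow₀ (by exact_mod_cast ht)
    have h2 : (1 : ℝ) ≤ 2 ^ t := one_le_pow₀ (by norm_num)
    nlinarith [mul_le_mul h1 h2 zero_le_one (zero_le_one.trans h1)]
  obtain ⟨N₁, hN₁⟩ := exists_threshold t (L * (t + 1)) (η := δ' / 2) (by positivity)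
  have hev : ∀ᶠ N : ℕ in atTop,
      ((primorial (truncLevel N) : ℕ) : ℝ) * (truncLevel N : ℝ) ^ t ≤ η * (N : ℝ) ^ (1 / 2 : ℝ) ∧
        (4 / δ) ^ 2 ≤ (N : ℝ) := by
    filter_upwards [primorial_mul_pow_truncLevel_eventually_le_sqrt t hη0,
      tendsto_natCast_atTop_atTop.eventually (eventually_ge_atTop ((4 / δ) ^ 2))] with N h1 h2
    exact ⟨h1, h2⟩
  obtain ⟨N₂, hN₂⟩ := Filter.eventually_atTop.1 hev
  refine ⟨max N₁ N₂, fun N hN q hq1 hqN a c u ha haL X hX hu => ?_⟩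
  obtain ⟨hNpos, hy2, hyL, hyT, hσ⟩ := hN₁ N (le_of_max_le_left hN)
  obtain ⟨hPy, hNδ⟩ := hN₂ N (le_of_max_le_right hN)
  have hN0 : (0 : ℝ) < N := by exact_mod_cast hNpos
  have hq : 0 < q := hq1
  set R : ℝ := Real.sqrt N with hR
  have hRrpow : (N : ℝ) ^ (1 / 2 : ℝ) = R := (Real.sqrt_eq_rpow (N : ℝ)).symm
  have hRR : R * R = N := Real.mul_self_sqrt hN0.le
  have hRδ : 4 / δ ≤ R := (Real.le_sqrt (by positivity) hN0.le).2 hNδ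
  rw [hRrpow] at hPy
  have hqR : (q : ℝ) ≤ R := by
    rw [← hRrpow]
    exact hqN.trans (Real.rpow_le_rpow_of_exponent_le (by exact_mod_cast hNpos) hθ)
  have hy1 : (1 : ℝ) ≤ (truncLevel N : ℝ) ^ t :=
    one_le_pow₀ (by exact_mod_cast (le_trans (by norm_num) hy2 : 1 ≤ truncLevel N))
  have hP1 : (1 : ℝ) ≤ (primorial (truncLevel N) : ℕ) := by exact_mod_cast primorial_pos _
  have hPR : ((primorial (truncLevel N) : ℕ) : ℝ) ≤ η * R :=
    le_trans (le_mul_of_one_le_right (by positivity) hy1) hPy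
  have hyR : (truncLevel N : ℝ) ^ t ≤ η * R :=
    le_trans (le_mul_of_one_le_left (by positivity) hP1) hPy
  have hest := coset_estimate hNpos hq hy2 hyL hyT ht hδ'0 hδ'1 hσ hδ hη0 hηδ hRR hqR hRδ hPR hyR
    a c u ha haL X hX hu
  refine hest.trans ?_
  have hB : δ' * 2 ^ t + 2 ^ t * t * (η / δ) + 2 * t ^ 2 * 2 ^ t * (η / δ) ≤ ε := by
    have e1 : δ' * 2 ^ t = ε₁ / 4 := by
      rw [hδ', pow_add]
      field_simp
      ring
    have e2 : 2 ^ t * t * (η / δ) = ε₁ / (8 * t) := by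
      rw [hη]
      field_simp
    have e3 : 2 * t ^ 2 * 2 ^ t * (η / δ) = ε₁ / 4 := by
      rw [hη]
      field_simp
      ring
    rw [e1, e2, e3]
    have ht1 : (1 : ℝ) ≤ t := by exact_mod_cast ht
    have : ε₁ / (8 * t) ≤ ε₁ / 8 :=
      div_le_div_of_nonneg_left hε₁0.le (by norm_num) (by nlinarith)
    linarith
  have hW : ∏ l, (((X l : ℝ) + 1) / q) = (∏ l, ((X l : ℝ) + 1)) / (q : ℝ) ^ t := by
    rw [Finset.prod_div_distrib, Finset.prod_const, Finset.card_univ, Fintype.card_fin]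
  have hW0 : 0 ≤ ∏ l, (((X l : ℝ) + 1) / q) := Finset.prod_nonneg fun l _ => by positivity
  have hB0 : 0 ≤ δ' * 2 ^ t + 2 ^ t * t * (η / δ) + 2 * t ^ 2 * 2 ^ t * (η / δ) := by positivity
  calc localTypeFactor q a c * ((δ' * 2 ^ t + 2 ^ t * t * (η / δ) + 2 * t ^ 2 * 2 ^ t * (η / δ)) *
        ∏ l, (((X l : ℝ) + 1) / q))
      ≤ ((q : ℝ) / Nat.totient q) ^ t * (ε * ∏ l, (((X l : ℝ) + 1) / q)) :=
        mul_le_mul (localTypeFactor_le hq a c) (mul_le_mul_of_nonneg_right hB hW0)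
          (mul_nonneg hB0 hW0) (by positivity)
    _ = ε * ((q : ℝ) / Nat.totient q) ^ t * (∏ i, ((X i : ℝ) + 1)) / (q : ℝ) ^ t := by
        rw [hW]
        ring

end CosetMeanProof

open CosetMeanProof in
/-- **`stub_cosetSingularMean`** (registered stub of the line `gallagher-backwards-split`): COSET SINGULAR MEANS
below level `N^{θ₁}`, `θ₁ < 1/2` — over the non-degenerate shifts `b ≡ c (q)` of a box with sides `≥ δN`
inside `[−LN, LN]^t`, `∑ 𝔖(a, b) = (∏_{p ∣ q} β_p(a, c)) · #{b in the box-coset} + O(ε (q/φ(q))^t ∏(X_i+1)/q^t)`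
uniformly for `1 ≤ q ≤ N^{θ₁}` (Gallagher's exact local averages along the coset for `p ∤ q`, frozen local
factors for `p ∣ q`, uniform tails of the singular product, few degenerate shifts). -/
theorem stub_cosetSingularMean : ∀ θ₁ : ℝ, θ₁ < 1 / 2 → CosetSingularMean θ₁ :=
  fun _ hθ => cosetSingularMean_of_le_half hθ.le

end Summit.Parity.GeneralizedHardyLittlewood.Cruxes.RelativeDimOne.GallagherBackwardsSplit

end
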